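import Summits.QuantumFields.YangMills.Theorems.BalabanUVNodesN15KingModelCoverPureGauge
import Summits.QuantumFields.YangMills.Theorems.BalabanUVNodesN15KingModelToronHeatKernel
import Mathlib.Analysis.Normed.Algebra.MatrixExponential
import Mathlib.Topology.Algebra.Module.FiniteDimension
import HarnessLib

/-!
# BalabanUVNodes ∕ N15 — THE KING-MODEL RUNG (PART Ͻ-l): FINITE COVERS — THE HEAT SEMIGROUP DESCENDS: `Lifts` is closed under the matrix exponential, so the toron heat kernel
# `e^{−tM_ω}` on `T_K` is the finite image sum of the one on any cover `T_{K′}`; at trivial holonomy `e^{−tM_ω} = D_p^*·e^{−tM_1}·D_p` (character gauge of King's `A = 0` heat kernel),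
# hence on the base a finite CHARACTER-IMAGE SUM of King's real heat kernel `e^{−t(c(−Δ)+m²)}` of the cover
# (Track A, DAG node N15 = NE2; FAN-OUT v1.1 §N15 s3 «KING-MODEL RUNG … + what the curved case adds»; count-neutral)

HONEST FRAMING.  Count-neutral (cell `pub-ymgap`, seat `pub-ymgap-dag-n15-e` g45; `--supports stmt-QuantumFields-27247 --as helper` = K3ᴬ, KEY MAP v3).  King's `A = 0`
comparison model [King1986] at a constant abelian (flat) link field, FINE layer, proper-time ∕ heat-kernel form (PART Ͷ-g's `NormedSpace.exp (−t·toronOp)`, [DodziukMathai2006]-type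
discrete magnetic heat kernels at a flat multiplier); exact finite-dimensional identities.  NOT Bałaban's `G_k(U)`; NOT a node discharge (N15 of record untouched); nothing continuum ∕
ℝ⁴ ∕ OS ∕ Clay.

THE MATHEMATICS.  `Lifts π π A B` says `A·(f∘π) = (B·f)∘π`; it passes to powers (Ͻ-a) and, the exponential series converging in the finite-dimensional algebra (Mathlib
`NormedSpace.exp_series_hasSum_exp'` in the `ℓ^∞`-operator norm) and `C ↦ C·v`, `D ↦ (D·f)∘π` being continuous linear, to `e^{A}`, `e^{B}` by uniqueness of limits.  With Ͻ-c
(`M^{K′}_ω` lifts `M^K_ω`) the heat kernels descend: `e^{−tM^K_ω}(π x̃, y) = Σ_{π ỹ = y} e^{−tM^{K′}_ω}(x̃, ỹ)`; with Ͻ-d (`M_ω = D_p^*M_1D_p` at trivial holonomy) and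
`Matrix.exp_units_conj'`: `e^{−tM_ω} = D_p^*e^{−tM_1}D_p`, and `e^{−tM_1} = (e^{−t·lapF})_ℂ` (Ͷ-g `exp_neg_toronOp_zero_eq_map`).
PROVED HERE:
* §1 `mulVecRightCLM`∕`pullMulVecCLM` (defs: the two continuous linear maps), ★★★ **`Lifts.exp`** (`RCLike 𝕜`: `Lifts π π A B ⇒ Lifts π π (exp A) (exp B)`), `Lifts.exp_smul`;
* §2 ★★ **`exp_neg_toronOp_lifts`**, ★★★ **`exp_neg_toronOp_apply_eq_sum_cover`** (the toron heat kernel on the base = image sum of the cover's, every `ω`, every `t`), ★★ `exp_neg_lapF_lifts` ∕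
  ★★ **`exp_neg_lapF_apply_eq_sum_cover`** (King's real `A = 0` heat kernel: finite periodisation);
* §3 `charUnit` (def: `D_p` as a unit), ★★★ **`exp_neg_toronOp_eq_char_conj`** (`e^{−tM_ω} = D_p^*e^{−tM_1}D_p` when `χ_p(e_μ) = ω_μ`), ★★ **`exp_neg_toronOp_apply_eq_char`**
  (`e^{−tM_ω}(x,y) = χ̄_p(x)·(e^{−t·lapF})(x,y)·χ_p(y)`), ★ `norm_exp_neg_toronOp_apply_eq` (`= |e^{−t·lapF}(x,y)|` at trivial holonomy), ★★★ **`exp_neg_toronOp_apply_eq_charSum_cover`** (base torus,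
  finite-order holonomy: character-image sum of King's real heat kernel of the cover).
PRIOR TREE ART (by name): Ͻ-a (`Lifts`, `.pow`, `.smul`, `.neg`, `.apply_eq_sum_fiber`), Ͻ-b (`proj`, `proj_surjective`, `fiber`), Ͻ-c (`toronOp_lifts`, `lapF_lifts`), Ͻ-d (`toronOp_eq_char_conj`,
`charDiag_mul_conjTranspose`, `conjTranspose_mul_charDiag`, `exists_char_of_pow_eq_one`, `norm_eq_one_of_pow_period`), Ͷ-g (`exp_neg_toronOp_zero_eq_map`), Ε-e (`norm_chi_eq_one`),
`B5ToronMomentum161.twistOf_zero`, Mathlib (`NormedSpace.exp_series_hasSum_exp'`, `ContinuousLinearMap.hasSum`, `HasSum.unique`, `LinearMap.toContinuousLinearMap`, `Matrix.exp_units_conj'`,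
scoped `Matrix.Norms.Operator`).  Dedup (rg at filing): basename 0 files; needles `Lifts.exp|exp_neg_toronOp_lifts|exp_neg_toronOp_eq_char_conj|charUnit` 0 tree files.  presearch: n/a.
Locators: [King1986] (4.4) p.670, (2.13) p.653; [Balaban1985BackgroundPropagators] (3.23) p.394, p.398 l.19; [DodziukMathai2006] §1 Thm 1.5 (discrete magnetic heat kernels; cited for the
object); [Balaban1984PropagatorsI] (1.29) p.23.  0 `sorry`, 3 `def`.
-/

noncomputable section

open scoped BigOperators ComplexConjugate ComplexOrder
open Finset Matrix

namespace Summit.QuantumFields.YangMills.BalabanUVNodes.N15KingModelRung.Cover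

open Literature.MathematicalPhysics.QuantumFieldTheory.Balaban1983to89.B5Prop11Plancherel (Tor unitVec chi)
open Literature.MathematicalPhysics.QuantumFieldTheory.Balaban1983to89.B5ToronMomentum161 (twistOf twistOf_zero)
open Literature.MathematicalPhysics.QuantumFieldTheory.King1986.Torus (lapF)
open Summit.QuantumFields.YangMills.BalabanUVNodes.N15KingModelRung.Toron (toronOp exp_neg_toronOp_zero_eq_map)
open Summit.QuantumFields.YangMills.BalabanUVNodes.N15KingModelRung.TorusSpectral (norm_chi_eq_one)

/-! ## §1 `Lifts` is closed under the exponential -/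

section Exp

variable {𝕜 : Type*} [RCLike 𝕜] {X X' : Type*} [Fintype X] [Fintype X'] [DecidableEq X] [DecidableEq X']

/-- `C ↦ C·v` as a continuous linear map of the MATRIX (finite dimensions). [folklore] -/
def mulVecRightCLM (v : X' → 𝕜) : Matrix X' X' 𝕜 →L[𝕜] (X' → 𝕜) :=
  LinearMap.toContinuousLinearMap
    { toFun := fun C => C *ᵥ v
      map_add' := fun C D => Matrix.add_mulVec C D v
      map_smul' := fun c C => Matrix.smul_mulVec c C v }

/-- `D ↦ (D·f) ∘ π` as a continuous linear map of the matrix. [folklore] -/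
def pullMulVecCLM (π : X' → X) (f : X → 𝕜) : Matrix X X 𝕜 →L[𝕜] (X' → 𝕜) :=
  LinearMap.toContinuousLinearMap
    { toFun := fun D => (D *ᵥ f) ∘ π
      map_add' := fun C D => by funext x; simp [Matrix.add_mulVec]
      map_smul' := fun c C => by funext x; simp [Matrix.smul_mulVec] }

omit [DecidableEq X] [DecidableEq X'] in
/-- Values of `mulVecRightCLM`. [folklore] -/
@[simp] theorem mulVecRightCLM_apply (v : X' → 𝕜) (C : Matrix X' X' 𝕜) : mulVecRightCLM v C = C *ᵥ v := rfl

omit [Fintype X'] [DecidableEq X] [DecidableEq X'] in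
/-- Values of `pullMulVecCLM`. [folklore] -/
@[simp] theorem pullMulVecCLM_apply (π : X' → X) (f : X → 𝕜) (D : Matrix X X 𝕜) : pullMulVecCLM π f D = (D *ᵥ f) ∘ π := rfl

open scoped Matrix.Norms.Operator in
/-- ★★★ **THE EXPONENTIAL DESCENDS**: if `A` lifts `B` along `π` then `e^{A}` lifts `e^{B}` (the exponential series converges; both sides are limits of series that agree term by term by
`Lifts.pow`). [folklore] -/
theorem Lifts.exp {π : X' → X} {A : Matrix X' X' 𝕜} {B : Matrix X X 𝕜} (h : Lifts π π A B) : Lifts π π (NormedSpace.exp A) (NormedSpace.exp B) := by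
  intro f
  have hA := (mulVecRightCLM (𝕜 := 𝕜) (f ∘ π)).hasSum (NormedSpace.exp_series_hasSum_exp' (𝕂 := 𝕜) A)
  have hB := (pullMulVecCLM (𝕜 := 𝕜) π f).hasSum (NormedSpace.exp_series_hasSum_exp' (𝕂 := 𝕜) B)
  simp only [mulVecRightCLM_apply, pullMulVecCLM_apply] at hA hB
  have heq : (fun n : ℕ => ((n.factorial : 𝕜)⁻¹ • A ^ n) *ᵥ (f ∘ π)) = fun n : ℕ => (((n.factorial : 𝕜)⁻¹ • B ^ n) *ᵥ f) ∘ π :=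
    funext fun n => ((h.pow n).smul _) f
  rw [heq] at hA
  exact hA.unique hB

/-- The exponential of a scalar multiple descends (`e^{tA}` lifts `e^{tB}`). [folklore] -/
theorem Lifts.exp_smul {π : X' → X} {A : Matrix X' X' 𝕜} {B : Matrix X X 𝕜} (h : Lifts π π A B) (t : 𝕜) :
    Lifts π π (NormedSpace.exp (t • A)) (NormedSpace.exp (t • B)) :=
  (h.smul t).exp

/-- `e^{−tA}` lifts `e^{−tB}`. [folklore] -/
theorem Lifts.exp_neg_smul {π : X' → X} {A : Matrix X' X' 𝕜} {B : Matrix X X 𝕜} (h : Lifts π π A B) (t : 𝕜) :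
    Lifts π π (NormedSpace.exp (-(t • A))) (NormedSpace.exp (-(t • B))) :=
  (h.smul t).neg.exp

end Exp

/-! ## §2 The toron heat kernel and King's `A = 0` heat kernel descend -/

section Descent

variable {d : ℕ} {K K' : Fin (d + 1) → ℕ} [hK : ∀ μ, NeZero (K μ)] [hK' : ∀ μ, NeZero (K' μ)]

/-- ★★ **THE TORON HEAT SEMIGROUP DESCENDS**: `e^{−tM^{K′}_ω}` lifts `e^{−tM^K_ω}` along every covering, every `ω`, every complex `t`. [cite: King1986, (4.4) p.670; Balaban1985BackgroundPropagators, (3.23) p.394] -/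
theorem exp_neg_toronOp_lifts (h : ∀ μ, K μ ∣ K' μ) (c m2 : ℝ) (ω : Fin (d + 1) → ℂ) (t : ℂ) :
    Lifts (proj h) (proj h) (NormedSpace.exp (-(t • toronOp K' c m2 ω))) (NormedSpace.exp (-(t • toronOp K c m2 ω))) :=
  (toronOp_lifts h c m2 ω).exp_neg_smul t

/-- ★★★ **THE TORON HEAT KERNEL ON THE BASE IS THE IMAGE SUM OF THE COVER's**: `e^{−tM^K_ω}(π x̃, y) = Σ_{ỹ : π ỹ = y} e^{−tM^{K′}_ω}(x̃, ỹ)`.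
[cite: King1986, (4.4) p.670; DodziukMathai2006, §1 Thm 1.5 (discrete magnetic heat kernel, the object)] -/
theorem exp_neg_toronOp_apply_eq_sum_cover (h : ∀ μ, K μ ∣ K' μ) (c m2 : ℝ) (ω : Fin (d + 1) → ℂ) (t : ℂ) (x' : Tor K') (y : Tor K) :
    NormedSpace.exp (-(t • toronOp K c m2 ω)) (proj h x') y = ∑ y' ∈ fiber (proj h) y, NormedSpace.exp (-(t • toronOp K' c m2 ω)) x' y' :=
  (exp_neg_toronOp_lifts h c m2 ω t).apply_eq_sum_fiber x' y

/-- ★★ **KING's REAL `A = 0` HEAT SEMIGROUP DESCENDS**: `e^{−t(c(−Δ)+m²)}` on `T_{K′}` lifts the one on `T_K`. [cite: King1986, (4.4) p.670, (2.13) p.653] -/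
theorem exp_neg_lapF_lifts (h : ∀ μ, K μ ∣ K' μ) (c m2 t : ℝ) :
    Lifts (proj h) (proj h) (NormedSpace.exp (-(t • lapF K' c m2))) (NormedSpace.exp (-(t • lapF K c m2))) :=
  (lapF_lifts h c m2).exp_neg_smul t

/-- ★★ **FINITE PERIODISATION OF KING's `A = 0` HEAT KERNEL**: `e^{−t·lapF_K}(π x̃, y) = Σ_{ỹ : π ỹ = y} e^{−t·lapF_{K′}}(x̃, ỹ)`. [cite: King1986, (4.4) p.670, (2.13) p.653] -/
theorem exp_neg_lapF_apply_eq_sum_cover (h : ∀ μ, K μ ∣ K' μ) (c m2 t : ℝ) (x' : Tor K') (y : Tor K) :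
    NormedSpace.exp (-(t • lapF K c m2)) (proj h x') y = ∑ y' ∈ fiber (proj h) y, NormedSpace.exp (-(t • lapF K' c m2)) x' y' :=
  (exp_neg_lapF_lifts h c m2 t).apply_eq_sum_fiber x' y

end Descent

/-! ## §3 Trivial holonomy: the toron heat kernel is the character gauge of King's heat kernel -/

section Char

variable {d : ℕ} (K : Fin (d + 1) → ℕ) [hK : ∀ μ, NeZero (K μ)]

/-- `D_p = diag(χ_p)` as a UNIT of the matrix ring (inverse `D_p^*`). [folklore] -/
def charUnit (p : Tor K) : (Matrix (Tor K) (Tor K) ℂ)ˣ :=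
  ⟨diagonal (chi K p), (diagonal (chi K p))ᴴ, charDiag_mul_conjTranspose K p, conjTranspose_mul_charDiag K p⟩

/-- The unit is `D_p`. [folklore] -/
@[simp] theorem charUnit_val (p : Tor K) : ((charUnit K p : (Matrix (Tor K) (Tor K) ℂ)ˣ) : Matrix (Tor K) (Tor K) ℂ) = diagonal (chi K p) := rfl

/-- Its inverse is `D_p^*`. [folklore] -/
@[simp] theorem charUnit_inv_val (p : Tor K) : ((charUnit K p)⁻¹ : (Matrix (Tor K) (Tor K) ℂ)ˣ) = ((diagonal (chi K p))ᴴ : Matrix (Tor K) (Tor K) ℂ) := rfl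

/-- ★★★ **`e^{−tM_ω} = D_p^*·e^{−tM_1}·D_p`** whenever `χ_p(e_μ) = ω_μ`: the toron heat semigroup at trivial holonomy is the character gauge of King's `A = 0` heat semigroup.
[cite: Balaban1985BackgroundPropagators, p.398 l.19; King1986, (4.4) p.670] -/
theorem exp_neg_toronOp_eq_char_conj (c m2 : ℝ) (t : ℂ) {p : Tor K} {ω : Fin (d + 1) → ℂ} (hω : ∀ μ, chi K p (unitVec K μ) = ω μ) :
    NormedSpace.exp (-(t • toronOp K c m2 ω)) = (diagonal (chi K p))ᴴ * NormedSpace.exp (-(t • toronOp K c m2 (1 : Fin (d + 1) → ℂ))) * diagonal (chi K p) := by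
  have hconj : -(t • toronOp K c m2 ω) = ((charUnit K p)⁻¹ : (Matrix (Tor K) (Tor K) ℂ)ˣ) * (-(t • toronOp K c m2 (1 : Fin (d + 1) → ℂ))) * (charUnit K p : Matrix (Tor K) (Tor K) ℂ) := by
    rw [toronOp_eq_char_conj K c m2 hω, charUnit_inv_val, charUnit_val, Matrix.mul_neg, Matrix.neg_mul, Matrix.mul_smul, Matrix.smul_mul]
  rw [hconj, Matrix.exp_units_conj', charUnit_inv_val, charUnit_val]

/-- ★★ **ENTRYWISE**: `e^{−tM_ω}(x,y) = χ̄_p(x)·(e^{−t·lapF})(x,y)·χ_p(y)` for real `t` (`χ_p(e_μ) = ω_μ`; Ͷ-g's `e^{−tM_1} = (e^{−t·lapF})_ℂ`).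
[cite: King1986, (4.4) p.670; Balaban1985BackgroundPropagators, p.398 l.19] -/
theorem exp_neg_toronOp_apply_eq_char (c m2 t : ℝ) {p : Tor K} {ω : Fin (d + 1) → ℂ} (hω : ∀ μ, chi K p (unitVec K μ) = ω μ) (x y : Tor K) :
    NormedSpace.exp (-(((t : ℝ) : ℂ) • toronOp K c m2 ω)) x y
      = conj (chi K p x) * (((NormedSpace.exp (-(t • lapF K c m2))) x y : ℝ) : ℂ) * chi K p y := by
  rw [exp_neg_toronOp_eq_char_conj K c m2 ((t : ℝ) : ℂ) hω, ← twistOf_zero, exp_neg_toronOp_zero_eq_map, Matrix.mul_apply]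
  simp only [Matrix.diagonal_conjTranspose, Matrix.diagonal_mul, Pi.star_apply, Complex.star_def, Matrix.map_apply]
  rw [Finset.sum_eq_single y (fun z _ hz => by rw [Matrix.diagonal_apply_ne _ hz, mul_zero]) (fun h => absurd (Finset.mem_univ y) h), Matrix.diagonal_apply_eq]

/-- ★ AT TRIVIAL HOLONOMY THE HEAT KERNEL HAS KING's MODULI: `‖e^{−tM_ω}(x,y)‖ = |e^{−t·lapF}(x,y)|` (`ω_μ^{K_μ} = 1`). [cite: King1986, (4.4) p.670] -/
theorem norm_exp_neg_toronOp_apply_eq (c m2 t : ℝ) {ω : Fin (d + 1) → ℂ} (hω : ∀ μ, ω μ ^ K μ = 1) (x y : Tor K) :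
    ‖NormedSpace.exp (-(((t : ℝ) : ℂ) • toronOp K c m2 ω)) x y‖ = |(NormedSpace.exp (-(t • lapF K c m2))) x y| := by
  obtain ⟨p, hp⟩ := exists_char_of_pow_eq_one K hω
  rw [exp_neg_toronOp_apply_eq_char K c m2 t hp, norm_mul, norm_mul, Complex.norm_conj, norm_chi_eq_one, norm_chi_eq_one, one_mul, mul_one, Complex.norm_real,
    Real.norm_eq_abs]

variable {K} {K' : Fin (d + 1) → ℕ} [hK' : ∀ μ, NeZero (K' μ)]

/-- ★★★ **THE TORON HEAT KERNEL ON THE BASE AS A CHARACTER-IMAGE SUM OF KING's REAL HEAT KERNEL OF THE COVER** (`K_μ ∣ K′_μ`, `ω_μ^{K′_μ} = 1`, `χ_p(e_μ) = ω_μ` on `T_{K′}`, real `t`):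
`e^{−tM^K_ω}(π x̃, y) = Σ_{ỹ : π ỹ = y} χ̄_p(x̃)·(e^{−t·lapF_{K′}})(x̃, ỹ)·χ_p(ỹ)`. [cite: King1986, (4.4) p.670; Balaban1984PropagatorsI, (1.29) p.23; Balaban1985BackgroundPropagators, p.398 l.19] -/
theorem exp_neg_toronOp_apply_eq_charSum_cover (h : ∀ μ, K μ ∣ K' μ) (c m2 t : ℝ) {p : Tor K'} {ω : Fin (d + 1) → ℂ} (hp : ∀ μ, chi K' p (unitVec K' μ) = ω μ)
    (x' : Tor K') (y : Tor K) :
    NormedSpace.exp (-(((t : ℝ) : ℂ) • toronOp K c m2 ω)) (proj h x') y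
      = ∑ y' ∈ fiber (proj h) y, conj (chi K' p x') * (((NormedSpace.exp (-(t • lapF K' c m2))) x' y' : ℝ) : ℂ) * chi K' p y' := by
  rw [exp_neg_toronOp_apply_eq_sum_cover h c m2 ω ((t : ℝ) : ℂ) x' y]
  exact Finset.sum_congr rfl fun y' _ => exp_neg_toronOp_apply_eq_char K' c m2 t hp x' y'

/-- ★★ **THE MODULI PERIODISE**: `‖e^{−tM^K_ω}(π x̃, y)‖ ≤ Σ_{fibre}|e^{−t·lapF_{K′}}(x̃, ỹ)|` for every toron of finite-order holonomy (`ω_μ^{K′_μ} = 1`). [cite: King1986, (4.4) p.670] -/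
theorem norm_exp_neg_toronOp_apply_le_sum_cover (h : ∀ μ, K μ ∣ K' μ) (c m2 t : ℝ) {ω : Fin (d + 1) → ℂ} (hω : ∀ μ, ω μ ^ K' μ = 1) (x' : Tor K') (y : Tor K) :
    ‖NormedSpace.exp (-(((t : ℝ) : ℂ) • toronOp K c m2 ω)) (proj h x') y‖ ≤ ∑ y' ∈ fiber (proj h) y, |(NormedSpace.exp (-(t • lapF K' c m2))) x' y'| := by
  refine ((exp_neg_toronOp_lifts h c m2 ω ((t : ℝ) : ℂ)).norm_apply_le x' y).trans (le_of_eq ?_)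
  exact Finset.sum_congr rfl fun y' _ => norm_exp_neg_toronOp_apply_eq K' c m2 t hω x' y'

end Char

end Summit.QuantumFields.YangMills.BalabanUVNodes.N15KingModelRung.Cover

end
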